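import Literature.NumberTheory.EllipticCurves.CongruentNumberEvenMonskySelmerLocal
import HarnessLib

/-!
# Monsky's `2`-Selmer formula, `≥` half: the candidate pairs `(∏ pᵢ^{αᵢ}, ± ∏ pᵢ^{βᵢ})` and their local data

For distinct odd primes `p₁, …, p_k` and a bit vector `α : Fin k → ℤ/2`, put `a_α = ∏_{αᵢ = 1} pᵢ` (`bitProd`).
The lower bound of Monsky's formula `#Sel⁽²⁾(E_n/ℚ) = 2^{2+s(n)}` (appendix to Heath-Brown, Invent. Math. 118
(1994); even `n = 2p₁⋯p_k` p. 41, odd `n = p₁⋯p_k` p. 39) attaches to every vector `(β; α) ∈ ker M` the pair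
`(a, b) = (a_α, ± a_β)` and shows that its class is a Selmer class (`CongruentNumber*MonskySelmerExact.lean`).
This file computes, uniformly in `k`, the LOCAL DATA of such pairs in the tree's rational currency
(`parityBit`, `qrBit`, `signBit`, `chi4`, `chi8`, `res8`):

* §1 `chi8` on odd primes is Monsky's additive symbol `[(2/q) = −1]` (`chi8_natCast_eq_addLegendreSym`), and
  `chi8` of a product; odd residues modulo `8` are determined by `(chi4, chi8)` (`res8_eq_of_chi4_chi8`);
* §2 `bitProd p α`: positivity, `v_{pᵢ}(a_α) = αᵢ` (`parityBit_bitProd`), `v_r(a_α) = 0` off `{pᵢ}`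
  (`padicValRat_bitProd_of_forall_ne`), primes dividing `a_α` are among the `pᵢ`,
  `qr_{pᵢ}(a_α) = Σ_{j ≠ i} A_ij αⱼ` (`qrBit_bitProd`), `χ₄(a_α) = Σ uⱼ αⱼ`, `χ₈(a_α) = Σ wⱼ αⱼ`
  (`u = [−1]`, `w = [2]`, `A_ij = [(pⱼ/pᵢ) = −1]`, Monsky's notation);
* §3 the same for `−a_α` (sign, `qr`, `χ₄`, `χ₈`).

Pure bookkeeping (theorems + one definition with body); no named fact. Cell `bsd-monsky` (prover-B).

## References

* [HeathBrown1994SelmerCongruentII] D. R. Heath-Brown, Invent. Math. 118 (1994) 331–370, Appendix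
  (P. Monsky), typescript p. 39 L1–L13 ("making the pair `(a, b)` correspond to the vector `x ∈ ℤ₂^{2n}`,
  where `xᵢ = 1` iff `pᵢ ∣ a`"), p. 41 L1–L19.
* [SilvermanAEC2009] J. H. Silverman, *The Arithmetic of Elliptic Curves*, 2nd ed., Example X.1.5.
-/

noncomputable section

open scoped Classical

open Literature.NumberTheory.EllipticCurves.KramerTwoDescent
open Literature.NumberTheory.EllipticCurves.TwoDescentLocal
open Literature.NumberTheory.EllipticCurves.HeathBrown1994
open Literature.NumberTheory.EllipticCurves.CongruentNumberEvenMonskySelmer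

namespace Literature.NumberTheory.EllipticCurves

namespace MonskySelmerCandidates

/-! ## §1 `chi8` and residues modulo `8` -/

/-- `chi8` of an odd integer, read off its class mod `8`: `1` iff `≡ ±3 (mod 8)`.
[cite: SilvermanAEC2009, Example X.1.5] -/
theorem chi8_intCast {z : ℤ} (hz : ¬ (2 : ℤ) ∣ z) :
    chi8 (z : ℚ) = if z % 8 = 3 ∨ z % 8 = 5 then 1 else 0 := by
  rw [chi8, res8_intCast hz, chi8Of]
  have hcast : (z : ZMod (2 ^ 3)) = ((z % 8 : ℤ) : ZMod (2 ^ 3)) := by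
    rw [show (2 : ℕ) ^ 3 = 8 from rfl]
    exact (ZMod.intCast_mod z 8).symm
  rw [hcast]
  have h8 : z % 8 = 1 ∨ z % 8 = 3 ∨ z % 8 = 5 ∨ z % 8 = 7 := by omega
  rcases h8 with h | h | h | h <;> rw [h] <;> decide

/-- `chi8 (−1) = 0`. [cite: SilvermanAEC2009, Example X.1.5] -/
theorem chi8_neg_one : chi8 (-1) = 0 := by
  rw [show (-1 : ℚ) = ((-1 : ℤ) : ℚ) by norm_num, chi8_intCast (by decide)]; decide

/-- **`chi8 q = [(2/q) = −1]` for an odd prime `q`** (`q ≡ ±3 (mod 8)` on both sides: the second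
supplementary law). [cite: HeathBrown1994SelmerCongruentII, Appendix (Monsky), typescript p. 39 L10–L13] -/
theorem chi8_natCast_eq_addLegendreSym {q : ℕ} (hq : q.Prime) (hq2 : q ≠ 2) :
    chi8 (q : ℚ) = addLegendreSym 2 q := by
  have hodd : q % 2 = 1 := Nat.odd_iff.mp (hq.odd_of_ne_two hq2)
  have hodd' : ¬ (2 : ℤ) ∣ (q : ℤ) := by omega
  have hj : jacobiSym 2 q = if q % 8 = 1 ∨ q % 8 = 7 then 1 else -1 := by
    rw [jacobiSym.at_two (Nat.odd_iff.mpr hodd), ZMod.χ₈_nat_eq_if_mod_eight, if_neg (by omega)]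
  rw [show (q : ℚ) = ((q : ℤ) : ℚ) by push_cast; rfl, chi8_intCast hodd']
  have h8 : q % 8 = 1 ∨ q % 8 = 3 ∨ q % 8 = 5 ∨ q % 8 = 7 := by omega
  rcases h8 with h | h | h | h
  · rw [if_neg (by omega), addLegendreSym_of_eq_one (by rw [hj, if_pos (Or.inl h)])]
  · rw [if_pos (by omega), addLegendreSym_of_eq_neg_one (by rw [hj, if_neg (by omega)])]
  · rw [if_pos (by omega), addLegendreSym_of_eq_neg_one (by rw [hj, if_neg (by omega)])]
  · rw [if_neg (by omega), addLegendreSym_of_eq_one (by rw [hj, if_pos (Or.inr h)])]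

/-- `chi8` of a finite product of non-zero rationals. [cite: SilvermanAEC2009, Example X.1.5] -/
theorem chi8_finset_prod {ι : Type*} (s : Finset ι) (f : ι → ℚ) (hf : ∀ i ∈ s, f i ≠ 0) :
    chi8 (∏ i ∈ s, f i) = ∑ i ∈ s, chi8 (f i) := by
  classical
  induction s using Finset.induction_on with
  | empty =>
    simp only [Finset.prod_empty, Finset.sum_empty]
    rw [show (1 : ℚ) = ((1 : ℤ) : ℚ) by norm_num, chi8_intCast (by decide)]; decide
  | insert a s ha ih =>
    have hs : ∀ i ∈ s, f i ≠ 0 := fun i hi => hf i (Finset.mem_insert_of_mem hi)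
    rw [Finset.prod_insert ha, Finset.sum_insert ha,
      chi8_mul (hf a (Finset.mem_insert_self a s)) (Finset.prod_ne_zero_iff.mpr hs), ih hs]

/-- `chi4` of a finite product of non-zero rationals. [cite: SilvermanAEC2009, Example X.1.5] -/
theorem chi4_finset_prod {ι : Type*} (s : Finset ι) (f : ι → ℚ) (hf : ∀ i ∈ s, f i ≠ 0) :
    chi4 (∏ i ∈ s, f i) = ∑ i ∈ s, chi4 (f i) := by
  classical
  induction s using Finset.induction_on with
  | empty => simp [chi4_one]
  | insert a s ha ih =>
    have hs : ∀ i ∈ s, f i ≠ 0 := fun i hi => hf i (Finset.mem_insert_of_mem hi)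
    rw [Finset.prod_insert ha, Finset.sum_insert ha,
      chi4_mul (hf a (Finset.mem_insert_self a s)) (Finset.prod_ne_zero_iff.mpr hs), ih hs]

/-- **An odd residue mod `8` is determined by `(chi4, chi8)`**: for `q ≠ 0`, `res8 q` is `1, 5, 7, 3`
according as `(chi4 q, chi8 q) = (0,0), (0,1), (1,0), (1,1)`; in particular two non-zero rationals with the
same `chi4` and `chi8` have the same `res8`. [cite: SilvermanAEC2009, Example X.1.5] -/
theorem res8_eq_of_chi4_chi8 {q q' : ℚ} (hq : q ≠ 0) (hq' : q' ≠ 0) (h4 : chi4 q = chi4 q')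
    (h8 : chi8 q = chi8 q') : res8 q = res8 q' := by
  have key : ∀ r s : ZMod (2 ^ 3), r * r = 1 → s * s = 1 → chi4Of r = chi4Of s → chi8Of r = chi8Of s → r = s := by
    decide
  exact key _ _ (res8_mul_self hq) (res8_mul_self hq') h4 h8

/-- `res8 q = 1` iff `chi4 q = 0` and `chi8 q = 0` (`q ≠ 0`). [cite: SilvermanAEC2009, Example X.1.5] -/
theorem res8_eq_one_of_chi4_chi8 {q : ℚ} (hq : q ≠ 0) (h4 : chi4 q = 0) (h8 : chi8 q = 0) : res8 q = 1 := by
  have key : ∀ r : ZMod (2 ^ 3), r * r = 1 → chi4Of r = 0 → chi8Of r = 0 → r = 1 := by decide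
  exact key _ (res8_mul_self hq) h4 h8

/-- `res8 (q · q') = 1` when `res8 q = res8 q'` (odd residues square to `1`). [cite: SilvermanAEC2009, Example X.1.5] -/
theorem res8_mul_eq_one_of_eq {q q' : ℚ} (hq : q ≠ 0) (hq' : q' ≠ 0) (h : res8 q = res8 q') :
    res8 (q * q') = 1 := by
  rw [res8_mul hq hq', h, res8_mul_self hq']

/-! ## §2 The square-free products `a_α = ∏_{αᵢ = 1} pᵢ` -/

variable {k : ℕ} (p : Fin k → ℕ)

/-- **The square-free product selected by a bit vector**: `bitProd p α = ∏_{i : α i = 1} p i` — Monsky's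
correspondence "`xᵢ = 1` if and only if `pᵢ ∣ a`" between divisors of `p₁⋯p_k` and vectors of `ℤ₂^k`, read
backwards. [cite: HeathBrown1994SelmerCongruentII, Appendix (Monsky), typescript p. 39 L4–L9] -/
def bitProd (α : Fin k → ZMod 2) : ℕ :=
  ∏ i ∈ Finset.univ.filter (fun i => α i = 1), p i

variable {p}

/-- The two values of a bit. [folklore] -/
private theorem zmod2_cases (x : ZMod 2) : x = 0 ∨ x = 1 := by revert x; decide

/-- `a_α` as a rational is the product of the selected primes. [cite: HeathBrown1994SelmerCongruentII, Appendix (Monsky), typescript p. 39 L4–L9] -/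
theorem cast_bitProd (α : Fin k → ZMod 2) :
    (bitProd p α : ℚ) = ∏ i ∈ Finset.univ.filter (fun i => α i = 1), (p i : ℚ) := by
  rw [bitProd, Nat.cast_prod]

/-- `a_α > 0` for primes `pᵢ`. [cite: HeathBrown1994SelmerCongruentII, Appendix (Monsky), typescript p. 39 L4–L9] -/
theorem bitProd_pos (hp : ∀ i, (p i).Prime) (α : Fin k → ZMod 2) : 0 < bitProd p α :=
  Finset.prod_pos fun i _ => (hp i).pos

/-- `(a_α : ℚ) ≠ 0`. [cite: HeathBrown1994SelmerCongruentII, Appendix (Monsky), typescript p. 39 L4–L9] -/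
theorem cast_bitProd_ne_zero (hp : ∀ i, (p i).Prime) (α : Fin k → ZMod 2) : (bitProd p α : ℚ) ≠ 0 := by
  exact_mod_cast (bitProd_pos hp α).ne'

/-- `a_α` as a product over the image set of primes. [folklore] -/
private theorem cast_bitProd_image (hinj : Function.Injective p) (α : Fin k → ZMod 2) :
    (bitProd p α : ℚ) = ∏ q ∈ (Finset.univ.filter (fun i => α i = 1)).image p, (q : ℚ) := by
  rw [cast_bitProd, Finset.prod_image fun x _ y _ h => hinj h]

/-- **`v_{pᵢ}(a_α) = αᵢ`** (as `0`/`1`). [cite: HeathBrown1994SelmerCongruentII, Appendix (Monsky), typescript p. 39 L4–L9] -/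
theorem padicValRat_bitProd_self (hp : ∀ i, (p i).Prime) (hinj : Function.Injective p) (α : Fin k → ZMod 2)
    (i : Fin k) :
    haveI : Fact (p i).Prime := ⟨hp i⟩
    padicValRat (p i) (bitProd p α : ℚ) = if α i = 1 then 1 else 0 := by
  haveI : Fact (p i).Prime := ⟨hp i⟩
  rw [cast_bitProd_image hinj, padicValRat_prod_primes (fun q hq => by
    obtain ⟨j, -, rfl⟩ := Finset.mem_image.mp hq; exact hp j)]
  by_cases h : α i = 1
  · rw [if_pos h, if_pos (Finset.mem_image.mpr ⟨i, Finset.mem_filter.mpr ⟨Finset.mem_univ i, h⟩, rfl⟩)]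
  · rw [if_neg h, if_neg (fun hm => by
      obtain ⟨j, hj, hji⟩ := Finset.mem_image.mp hm
      exact h (hinj hji ▸ (Finset.mem_filter.mp hj).2))]

/-- **`parityBit pᵢ a_α = αᵢ`**. [cite: HeathBrown1994SelmerCongruentII, Appendix (Monsky), typescript p. 39 L4–L9] -/
theorem parityBit_bitProd (hp : ∀ i, (p i).Prime) (hinj : Function.Injective p) (α : Fin k → ZMod 2) (i : Fin k) :
    parityBit (p i) (bitProd p α : ℚ) = α i := by
  unfold parityBit
  rw [padicValRat_bitProd_self hp hinj α i]
  rcases zmod2_cases (α i) with h | h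
  · rw [h, if_neg (by decide)]; rfl
  · rw [h, if_pos rfl]; rfl

/-- **`v_r(a_α) = 0` at every prime `r` different from all `pⱼ`** (in particular at `2` and at the good primes).
[cite: HeathBrown1994SelmerCongruentII, Appendix (Monsky), typescript p. 39 L4–L9] -/
theorem padicValRat_bitProd_of_forall_ne (hp : ∀ i, (p i).Prime) (hinj : Function.Injective p)
    (α : Fin k → ZMod 2) {r : ℕ} (hr : r.Prime) (hrp : ∀ j, p j ≠ r) :
    haveI : Fact r.Prime := ⟨hr⟩
    padicValRat r (bitProd p α : ℚ) = 0 := by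
  haveI : Fact r.Prime := ⟨hr⟩
  rw [cast_bitProd_image hinj, padicValRat_prod_primes (fun q hq => by
    obtain ⟨j, -, rfl⟩ := Finset.mem_image.mp hq; exact hp j), if_neg (fun hm => by
      obtain ⟨j, -, hj⟩ := Finset.mem_image.mp hm; exact hrp j hj)]

/-- A prime dividing `a_α` is one of the `pᵢ` (with `αᵢ = 1`). [cite: HeathBrown1994SelmerCongruentII, Appendix (Monsky), typescript p. 39 L4–L9] -/
theorem exists_eq_of_prime_dvd_bitProd (hp : ∀ i, (p i).Prime) (α : Fin k → ZMod 2) {r : ℕ} (hr : r.Prime)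
    (hdvd : r ∣ bitProd p α) : ∃ i, α i = 1 ∧ p i = r := by
  rw [bitProd] at hdvd
  obtain ⟨i, hi, hri⟩ := (Prime.dvd_finsetProd_iff hr.prime _).mp hdvd
  exact ⟨i, (Finset.mem_filter.mp hi).2, ((Nat.prime_dvd_prime_iff_eq hr (hp i)).mp hri).symm⟩

/-- `a_α` divides `∏ pᵢ`. [cite: HeathBrown1994SelmerCongruentII, Appendix (Monsky), typescript p. 39 L4–L9] -/
theorem bitProd_dvd_prod (α : Fin k → ZMod 2) : bitProd p α ∣ ∏ i, p i :=
  Finset.prod_dvd_prod_of_subset _ _ _ (Finset.filter_subset _ _)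

/-- Parity off `{2, p₁, …, p_k}`: the hypothesis shape of `qrBit_expand` / `chi4_expand` for `a_α`.
[cite: HeathBrown1994SelmerCongruentII, Appendix (Monsky), typescript p. 39 L4–L9] -/
theorem even_padicValRat_bitProd (hp : ∀ i, (p i).Prime) (hinj : Function.Injective p) (α : Fin k → ZMod 2) :
    ∀ r : ℕ, r.Prime → r ≠ 2 → (∀ j, p j ≠ r) → Even (padicValRat r (bitProd p α : ℚ)) := by
  intro r hr _ hrp
  rw [padicValRat_bitProd_of_forall_ne hp hinj α hr hrp]
  exact ⟨0, rfl⟩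

/-- **`qr_{pᵢ}(a_α) = Σ_{j ≠ i} A_ij αⱼ`**, `A_ij = [(pⱼ/pᵢ) = −1]`.
[cite: HeathBrown1994SelmerCongruentII, Appendix (Monsky), typescript p. 39 L13–L26] -/
theorem qrBit_bitProd (hp : ∀ i, (p i).Prime) (hp2 : ∀ i, p i ≠ 2) (hinj : Function.Injective p)
    (α : Fin k → ZMod 2) (i : Fin k) :
    haveI : Fact (p i).Prime := ⟨hp i⟩
    qrBit (p i) (bitProd p α : ℚ) = ∑ j ∈ Finset.univ.erase i, addLegendreSym (p j) (p i) * α j := by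
  haveI : Fact (p i).Prime := ⟨hp i⟩
  haveI : Fact (Nat.Prime 2) := ⟨Nat.prime_two⟩
  rw [qrBit_expand hp hp2 hinj i (cast_bitProd_ne_zero hp α) (even_padicValRat_bitProd hp hinj α),
    (signBit_eq_zero_iff (cast_bitProd_ne_zero hp α)).mpr (by exact_mod_cast bitProd_pos hp α), zero_mul, zero_add]
  have h2 : parityBit 2 (bitProd p α : ℚ) = 0 := by
    unfold parityBit
    rw [padicValRat_bitProd_of_forall_ne hp hinj α Nat.prime_two hp2]; rfl
  rw [h2, mul_zero, zero_add]
  exact Finset.sum_congr rfl fun j _ => by rw [parityBit_bitProd hp hinj α j]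

/-- **`χ₄(a_α) = Σⱼ uⱼ αⱼ`**, `uⱼ = [(−1/pⱼ) = −1]`.
[cite: HeathBrown1994SelmerCongruentII, Appendix (Monsky), typescript p. 41 L1–L19] -/
theorem chi4_bitProd (hp : ∀ i, (p i).Prime) (hp2 : ∀ i, p i ≠ 2) (hinj : Function.Injective p)
    (α : Fin k → ZMod 2) : chi4 (bitProd p α : ℚ) = ∑ j, addLegendreSym (-1) (p j) * α j := by
  rw [chi4_expand hp hp2 hinj (cast_bitProd_ne_zero hp α) (even_padicValRat_bitProd hp hinj α),
    (signBit_eq_zero_iff (cast_bitProd_ne_zero hp α)).mpr (by exact_mod_cast bitProd_pos hp α), zero_add]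
  exact Finset.sum_congr rfl fun j _ => by rw [parityBit_bitProd hp hinj α j]

/-- **`χ₈(a_α) = Σⱼ wⱼ αⱼ`**, `wⱼ = [(2/pⱼ) = −1]`.
[cite: HeathBrown1994SelmerCongruentII, Appendix (Monsky), typescript p. 41 L1–L19] -/
theorem chi8_bitProd (hp : ∀ i, (p i).Prime) (hp2 : ∀ i, p i ≠ 2) (α : Fin k → ZMod 2) :
    chi8 (bitProd p α : ℚ) = ∑ j, addLegendreSym 2 (p j) * α j := by
  rw [cast_bitProd, chi8_finset_prod _ _ (fun j _ => Nat.cast_ne_zero.mpr (hp j).ne_zero)]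
  rw [← Finset.sum_filter_add_sum_filter_not Finset.univ (fun i => α i = 1) (fun j => addLegendreSym 2 (p j) * α j)]
  have h0 : ∑ j ∈ Finset.univ.filter (fun i => ¬ α i = 1), addLegendreSym 2 (p j) * α j = 0 :=
    Finset.sum_eq_zero fun j hj => by
      have hj' := (Finset.mem_filter.mp hj).2
      rcases zmod2_cases (α j) with h | h
      · rw [h, mul_zero]
      · exact absurd h hj'
  rw [h0, add_zero]
  exact Finset.sum_congr rfl fun j hj => by
    rw [(Finset.mem_filter.mp hj).2, mul_one, chi8_natCast_eq_addLegendreSym (hp j) (hp2 j)]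

/-! ## §3 The signed products `−a_α` -/

/-- `signBit (−a_α) = 1`. [cite: SilvermanAEC2009, Example X.1.5] -/
theorem signBit_neg_bitProd (hp : ∀ i, (p i).Prime) (α : Fin k → ZMod 2) : signBit (-(bitProd p α : ℚ)) = 1 := by
  unfold signBit
  rw [if_pos (neg_neg_of_pos (by exact_mod_cast bitProd_pos hp α))]

/-- `parityBit r (−x) = parityBit r x`. [cite: SilvermanAEC2009, Example X.1.5] -/
theorem parityBit_neg (r : ℕ) (x : ℚ) : parityBit r (-x) = parityBit r x := by
  unfold parityBit; rw [padicValRat.neg]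

/-- `qr_{pᵢ}(−a_α) = uᵢ + Σ_{j ≠ i} A_ij αⱼ`. [cite: HeathBrown1994SelmerCongruentII, Appendix (Monsky), typescript p. 39 L13–L26] -/
theorem qrBit_neg_bitProd (hp : ∀ i, (p i).Prime) (hp2 : ∀ i, p i ≠ 2) (hinj : Function.Injective p)
    (α : Fin k → ZMod 2) (i : Fin k) :
    haveI : Fact (p i).Prime := ⟨hp i⟩
    qrBit (p i) (-(bitProd p α : ℚ)) =
      addLegendreSym (-1) (p i) + ∑ j ∈ Finset.univ.erase i, addLegendreSym (p j) (p i) * α j := by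
  haveI : Fact (p i).Prime := ⟨hp i⟩
  rw [qrBit_neg (cast_bitProd_ne_zero hp α), qrBit_neg_one_eq_addLegendreSym, qrBit_bitProd hp hp2 hinj]

/-- `χ₄(−a_α) = 1 + Σⱼ uⱼ αⱼ`. [cite: SilvermanAEC2009, Example X.1.5] -/
theorem chi4_neg_bitProd (hp : ∀ i, (p i).Prime) (hp2 : ∀ i, p i ≠ 2) (hinj : Function.Injective p)
    (α : Fin k → ZMod 2) : chi4 (-(bitProd p α : ℚ)) = 1 + ∑ j, addLegendreSym (-1) (p j) * α j := by
  rw [show (-(bitProd p α : ℚ)) = -1 * (bitProd p α : ℚ) by ring, chi4_mul (by norm_num) (cast_bitProd_ne_zero hp α),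
    chi4_neg_one, chi4_bitProd hp hp2 hinj]

/-- `χ₈(−a_α) = Σⱼ wⱼ αⱼ`. [cite: SilvermanAEC2009, Example X.1.5] -/
theorem chi8_neg_bitProd (hp : ∀ i, (p i).Prime) (hp2 : ∀ i, p i ≠ 2) (α : Fin k → ZMod 2) :
    chi8 (-(bitProd p α : ℚ)) = ∑ j, addLegendreSym 2 (p j) * α j := by
  rw [show (-(bitProd p α : ℚ)) = -1 * (bitProd p α : ℚ) by ring, chi8_mul (by norm_num) (cast_bitProd_ne_zero hp α),
    chi8_neg_one, zero_add, chi8_bitProd hp hp2]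

end MonskySelmerCandidates

end Literature.NumberTheory.EllipticCurves

end
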